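import Summits.CriticalPhenomena.PercolationContinuityZ3.Theorems.PercNearOneGluingNoHeavyLowerTailSahiMomentExpansion
import Summits.CriticalPhenomena.PercolationContinuityZ3.Theorems.SahiMasterFamily

/-!
# The conditioning (cylinder-slot) identity for Sahi's `E_k` in DIVISION-FREE recursive form, every `k`, any weights

Support file of the one-cut programme (crux `NoHeavyLowerTail`, stmt-CriticalPhenomena-4575; cell `prim-masterthm`, seat P3; HIERARCHY.md §9).
Blinovsky's conditioning identity [Blinovsky2013] (tree: `Literature…FKGCumulation`, square-free generating functions, `private`) expands
`E_{k+1}(1_P, g_1,…,g_k)` for an event `P` of mass `t` into `t·Σ_S c_S·𝒫_{Sᶜ}(δ)` with `c_S = (|S|−1)E^{μ(·|P)}_{|S|}(g_S)` and `𝒫_T(δ)` a positive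
polynomial in the Harris differences `δ(g_B) = E[g_B | P] − E[g_B]`.  This file proves an equivalent identity WITHOUT generating functions,
partitions or division, for THREE arbitrary real weights `μ, μ', ν` on a finite set linked only by
  `ν = μ − μ'` (pointwise)   and   `E_μ[P₁·f] = t·E_{μ'}[f]` for all `f`   (e.g. `μ' = μ(·|P)`, `P₁ = 1_P`, `t = μ(P)`):

  **`sahiE_marked_eq`**:  `E^μ_{k+1}(P₁·h, g) = t · Σ_{S ⊆ [k]} E^{μ'}_{|S|+1}(h, g_S) · B_ν(g_{Sᶜ})`,   `B_ν(g_T) := [T = ∅] − E^ν_{|T|}(g_T)`,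

where `g_S` is the sub-family in increasing order (the tree's `fun j => g (S.orderEmbOfFin rfl j)` of `…SahiMomentExpansion`).  Here
`B_ν(g_T) = Σ_{π ⊢ T} ∏_B (|B|−1)!·δ(g_B)` is Blinovsky's `𝒫_T` (since `E_ν[f] = −δ(f)`), but we never need that: `B` obeys the Lieb–Sahi
recursion of `E^ν` (`sahiE_cons`), and the proof of the identity is a bare induction on `k` in which the three recursions (for `μ`, `μ'`, `ν`)
match term by term through `E_μ = E_{μ'} + E_ν`.  With `h = 1` and `μ'` a probability weight, `E^{μ'}_{|S|+1}(1, g_S) = (|S|−1)E^{μ'}_{|S|}(g_S)`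
(branching) recovers Blinovsky's form.  Consumer: `…SahiCombCylinder` (the all-`k` cylinder rung of the comb hierarchy: for the product weight
and a cylinder `P`, `μ'` is the frozen weight, `−E_ν = δ` is comb-positive, hence so is every `B_ν` and the whole right-hand side).
Exact pre-check (seat `work/py/check_star.py`): 40 random instances, arbitrary signed functions, `k ≤ 4`, 0 mismatches.
Everything here is proved; any weights, any functions; axioms standard. [this work]
-/

noncomputable section

open scoped Classical

namespace Summit.CriticalPhenomena.PercolationContinuityZ3.Theorems

namespace SahiCylinderIdentity

open Finset Function Literature.Combinatorics.Sahi2008 SahiMomentExpansion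

variable {α : Type*} [Fintype α]

/-! ### Peeling the SECOND slot of a `vecCons`-family -/

/-- Deleting slot `1` of `(a, g₀, f_0, …)` leaves `(a, f_0, …)`. [folklore] -/
theorem comp_succAbove_one {β : Type*} {m : ℕ} (a g₀ : β) (f : Fin m → β) :
    (fun j => (Matrix.vecCons a (Matrix.vecCons g₀ f) : Fin (m + 2) → β) ((1 : Fin (m + 2)).succAbove j)) = Matrix.vecCons a f := by
  funext j
  refine Fin.cases ?_ (fun i => ?_) j
  · rw [Fin.succAbove_ne_zero_zero one_ne_zero]; rfl
  · rw [← Fin.succ_zero_eq_one', Fin.succ_succAbove_succ, Fin.succAbove_zero]; rfl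

/-- **The Lieb–Sahi recursion peeled at the second slot**: for any weight,
`E_{m+2}(a, g₀, f) = E_{m+1}(a·g₀, f) + Σ_l E_{m+1}(a, f with f_l ↦ f_l·g₀) − E_{m+1}(a, f)·E(g₀)`. [cite: LiebSahi2021, Prop. 3.3 and Def. 3.1 (symmetry)] -/
theorem sahiE_peel_one (μ : α → ℝ) {m : ℕ} (a g₀ : α → ℝ) (f : Fin m → α → ℝ) :
    sahiE μ (m + 2) (Matrix.vecCons a (Matrix.vecCons g₀ f)) =
      sahiE μ (m + 1) (Matrix.vecCons (a * g₀) f)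
        + (∑ l : Fin m, sahiE μ (m + 1) (Matrix.vecCons a (update f l (f l * g₀))))
        - sahiE μ (m + 1) (Matrix.vecCons a f) * ex μ g₀ := by
  rw [sahiE_peel μ m (Matrix.vecCons a (Matrix.vecCons g₀ f)) 1]
  have hGl : ∀ l, (Matrix.vecCons a (Matrix.vecCons g₀ f) : Fin (m + 2) → α → ℝ) ((1 : Fin (m + 2)).succAbove l) =
      Matrix.vecCons a f l := fun l => congrFun (comp_succAbove_one a g₀ f) l
  have h1 : (Matrix.vecCons a (Matrix.vecCons g₀ f) : Fin (m + 2) → α → ℝ) 1 = g₀ := rfl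
  simp only [hGl, h1]
  rw [Fin.sum_univ_succ]
  have hz : update (Matrix.vecCons a f) 0 (Matrix.vecCons a f 0 * g₀) = Matrix.vecCons (a * g₀) f := by
    funext j
    refine Fin.cases ?_ (fun i => ?_) j
    · rw [update_self]; rfl
    · rw [update_of_ne (Fin.succ_ne_zero i)]; rfl
  have hs : ∀ l : Fin m, update (Matrix.vecCons a f) l.succ (Matrix.vecCons a f l.succ * g₀) =
      Matrix.vecCons a (update f l (f l * g₀)) := fun l => by
    funext j
    refine Fin.cases ?_ (fun i => ?_) j
    · rw [update_of_ne (Fin.succ_ne_zero l).symm]; rfl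
    · by_cases hil : i = l
      · subst hil; rw [update_self]; show _ = update f i (f i * g₀) i; rw [update_self]; rfl
      · rw [update_of_ne (fun h' => hil (Fin.succ_injective _ h'))]
        show f i = update f l (f l * g₀) i
        rw [update_of_ne hil]
  have hG : (fun l => Matrix.vecCons a f l) = Matrix.vecCons a f := rfl
  rw [hz, hG]
  simp only [hs]

/-- The Lieb–Sahi recursion for a family of size `m + 1` with `m > 0` (index arithmetic helper). [cite: LiebSahi2021, Prop. 3.3] -/
theorem sahiE_cons_of_pos (μ : α → ℝ) {m : ℕ} (hm : 0 < m) (f : α → ℝ) (F : Fin m → α → ℝ) :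
    sahiE μ (m + 1) (Matrix.vecCons f F) = (∑ i : Fin m, sahiE μ m (update F i (F i * f))) - sahiE μ m F * ex μ f := by
  obtain ⟨c, rfl⟩ := Nat.exists_eq_succ_of_ne_zero hm.ne'
  exact sahiE_cons μ c f F

/-- Transport along a cast of the tail index type. [folklore] -/
theorem sahiE_vecCons_cast (μ : α → ℝ) {m m' : ℕ} (hc : m = m') (h : α → ℝ) (F : Fin m' → α → ℝ) :
    sahiE μ (m + 1) (Matrix.vecCons h (fun j => F (Fin.cast hc j))) = sahiE μ (m' + 1) (Matrix.vecCons h F) := by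
  subst hc
  rfl

/-! ### The two functionals of the identity: the marked `μ'`-functional `A` and the `ν`-functional `B` -/

/-- `A_{μ'}(h; g, S) = E^{μ'}_{|S|+1}(h, g_S)` — the marked functional on the sub-family `S` (increasing enumeration). [this work] -/
def markedA (μ' : α → ℝ) (h : α → ℝ) {k : ℕ} (g : Fin k → α → ℝ) (S : Finset (Fin k)) : ℝ :=
  sahiE μ' (S.card + 1) (Matrix.vecCons h (fun j => g (S.orderEmbOfFin rfl j)))

/-- `B_ν(g, T) = [T = ∅] − E^ν_{|T|}(g_T)` (Blinovsky's partition polynomial `𝒫_T(δ)` when `E_ν = −δ`; `B_∅ = 1`). [this work] -/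
def polyB (ν : α → ℝ) {k : ℕ} (g : Fin k → α → ℝ) (T : Finset (Fin k)) : ℝ :=
  (if T = ∅ then 1 else 0) - sahiE ν T.card (fun j => g (T.orderEmbOfFin rfl j))

/-! ### Sub-family bookkeeping through the pivot `0` -/

/-- The increasing enumeration of `S'.map succ` is the shifted enumeration of `S'`. [folklore] -/
theorem orderEmbOfFin_map_zero {k : ℕ} (S' : Finset (Fin k)) (j : Fin (S'.map (Fin.succAboveEmb 0)).card) :
    (S'.map (Fin.succAboveEmb 0)).orderEmbOfFin rfl j =
      (0 : Fin (k + 1)).succAbove (S'.orderEmbOfFin rfl (Fin.cast (card_map (Fin.succAboveEmb 0)) j)) := by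
  have e2 : (fun i => (0 : Fin (k + 1)).succAbove (S'.orderEmbOfFin rfl i)) =
      (S'.map (Fin.succAboveEmb 0)).orderEmbOfFin (card_map _) :=
    Finset.orderEmbOfFin_unique _
      (fun i => (Finset.mem_map' (Fin.succAboveEmb 0)).mpr (orderEmbOfFin_mem S' rfl i))
      ((Fin.strictMono_succAbove 0).comp (S'.orderEmbOfFin rfl).strictMono)
  have e1 : (S'.map (Fin.succAboveEmb 0)).orderEmbOfFin rfl j =
      (S'.map (Fin.succAboveEmb 0)).orderEmbOfFin (card_map (Fin.succAboveEmb 0))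
        (Fin.cast (card_map (Fin.succAboveEmb 0)) j) :=
    Finset.orderEmbOfFin_eq_orderEmbOfFin_iff.mpr rfl
  rw [e1, ← congrFun e2 (Fin.cast (card_map (Fin.succAboveEmb 0)) j)]

/-- The card of `insert 0 (S'.map succ)`. [folklore] -/
theorem card_insert_zero_map {k : ℕ} (S' : Finset (Fin k)) :
    (insert (0 : Fin (k + 1)) (S'.map (Fin.succAboveEmb 0))).card = S'.card + 1 := by
  rw [card_insert_of_notMem (not_mem_map_succAboveEmb 0 S'), card_map]

/-- The increasing enumeration of `insert 0 (S'.map succ)` is `0` followed by the shifted enumeration of `S'`. [folklore] -/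
theorem orderEmbOfFin_insert_zero {k : ℕ} (S' : Finset (Fin k)) (j : Fin (S'.card + 1)) :
    (insert (0 : Fin (k + 1)) (S'.map (Fin.succAboveEmb 0))).orderEmbOfFin (card_insert_zero_map S') j =
      (Fin.cons (0 : Fin (k + 1)) (fun i => Fin.succ (S'.orderEmbOfFin rfl i)) : Fin (S'.card + 1) → Fin (k + 1)) j := by
  have hmono : StrictMono (Fin.cons (0 : Fin (k + 1)) (fun i => Fin.succ (S'.orderEmbOfFin rfl i)) :
      Fin (S'.card + 1) → Fin (k + 1)) := by
    intro x y hxy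
    revert hxy
    refine Fin.cases ?_ (fun b => ?_) y <;> refine Fin.cases ?_ (fun a => ?_) x <;> intro hxy
    · exact absurd hxy (lt_irrefl _)
    · exact absurd hxy (Fin.not_lt_zero _)
    · simp only [Fin.cons_zero, Fin.cons_succ]; exact Fin.succ_pos _
    · simp only [Fin.cons_succ]
      exact Fin.succ_lt_succ_iff.2 ((S'.orderEmbOfFin rfl).strictMono (Fin.succ_lt_succ_iff.1 hxy))
  have hmem : ∀ j, (Fin.cons (0 : Fin (k + 1)) (fun i => Fin.succ (S'.orderEmbOfFin rfl i)) : Fin (S'.card + 1) → Fin (k + 1)) j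
      ∈ insert (0 : Fin (k + 1)) (S'.map (Fin.succAboveEmb 0)) := by
    intro j
    refine Fin.cases ?_ (fun i => ?_) j
    · simp
    · simp only [Fin.cons_succ, mem_insert, Fin.succ_ne_zero, false_or, mem_map]
      exact ⟨S'.orderEmbOfFin rfl i, orderEmbOfFin_mem S' rfl i, by simp⟩
  exact (congrFun (Finset.orderEmbOfFin_unique (card_insert_zero_map S') hmem hmono) j).symm

omit [Fintype α] in
/-- Sub-family of `g` on `insert 0 (S'.map succ)` = `g 0` followed by the sub-family of the tail on `S'` (up to the card cast). [folklore] -/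
theorem subfamily_insert_zero {k : ℕ} (g : Fin (k + 1) → α → ℝ) (S' : Finset (Fin k)) :
    (fun j => g ((insert (0 : Fin (k + 1)) (S'.map (Fin.succAboveEmb 0))).orderEmbOfFin rfl j)) =
      fun j => (Matrix.vecCons (g 0) (fun i => Fin.removeNth 0 g (S'.orderEmbOfFin rfl i)) :
        Fin (S'.card + 1) → α → ℝ) (Fin.cast (card_insert_zero_map S') j) := by
  funext j
  have e1 : (insert (0 : Fin (k + 1)) (S'.map (Fin.succAboveEmb 0))).orderEmbOfFin rfl j =
      (insert (0 : Fin (k + 1)) (S'.map (Fin.succAboveEmb 0))).orderEmbOfFin (card_insert_zero_map S')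
        (Fin.cast (card_insert_zero_map S') j) :=
    Finset.orderEmbOfFin_eq_orderEmbOfFin_iff.mpr rfl
  rw [e1, orderEmbOfFin_insert_zero]
  generalize Fin.cast (card_insert_zero_map S') j = i
  refine Fin.cases ?_ (fun l => ?_) i
  · rfl
  · rfl

/-- `A` through the pivot, `0 ∉ S`: `A(h; g, S'.map succ) = A(h; tail g, S')`. [this work] -/
theorem markedA_map (μ' : α → ℝ) (h : α → ℝ) {k : ℕ} (g : Fin (k + 1) → α → ℝ) (S' : Finset (Fin k)) :
    markedA μ' h g (S'.map (Fin.succAboveEmb 0)) = markedA μ' h (Fin.removeNth 0 g) S' := by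
  unfold markedA
  have hfun : (fun j => g ((S'.map (Fin.succAboveEmb 0)).orderEmbOfFin rfl j)) =
      fun j => (fun i => Fin.removeNth 0 g (S'.orderEmbOfFin rfl i)) (Fin.cast (card_map (Fin.succAboveEmb 0)) j) := by
    funext j; rw [orderEmbOfFin_map_zero]; rfl
  rw [hfun]
  exact sahiE_vecCons_cast μ' (card_map (Fin.succAboveEmb 0)) h (fun i => Fin.removeNth 0 g (S'.orderEmbOfFin rfl i))

/-- `A` through the pivot, `0 ∈ S`: `A(h; g, insert 0 (S'.map succ)) = E^{μ'}_{|S'|+2}(h, g 0, (tail g)_{S'})`. [this work] -/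
theorem markedA_insert (μ' : α → ℝ) (h : α → ℝ) {k : ℕ} (g : Fin (k + 1) → α → ℝ) (S' : Finset (Fin k)) :
    markedA μ' h g (insert 0 (S'.map (Fin.succAboveEmb 0))) =
      sahiE μ' (S'.card + 2) (Matrix.vecCons h (Matrix.vecCons (g 0) (fun i => Fin.removeNth 0 g (S'.orderEmbOfFin rfl i)))) := by
  unfold markedA
  rw [subfamily_insert_zero, sahiE_vecCons_cast μ' (card_insert_zero_map S') h]

/-- `B` through the pivot, `0 ∉ T`: `B(g, T'.map succ) = B(tail g, T')`. [this work] -/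
theorem polyB_map (ν : α → ℝ) {k : ℕ} (g : Fin (k + 1) → α → ℝ) (T' : Finset (Fin k)) :
    polyB ν g (T'.map (Fin.succAboveEmb 0)) = polyB ν (Fin.removeNth 0 g) T' := by
  unfold polyB
  rw [subfamily_map_succAbove ν 0 T' g]
  simp only [Finset.map_eq_empty]

/-- `B` through the pivot, `0 ∈ T`: `B(g, insert 0 (T'.map succ)) = −E^ν_{|T'|+1}(g 0, (tail g)_{T'})`. [this work] -/
theorem polyB_insert (ν : α → ℝ) {k : ℕ} (g : Fin (k + 1) → α → ℝ) (T' : Finset (Fin k)) :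
    polyB ν g (insert 0 (T'.map (Fin.succAboveEmb 0))) =
      - sahiE ν (T'.card + 1) (Matrix.vecCons (g 0) (fun i => Fin.removeNth 0 g (T'.orderEmbOfFin rfl i))) := by
  unfold polyB
  rw [if_neg (insert_ne_empty _ _), zero_sub, subfamily_insert_zero, sahiE_cast ν (card_insert_zero_map T')]

/-! ### Restricting updates; sums along the enumeration -/

omit [Fintype α] in
/-- Restricting an updated family: updating slot `e l` of `g` restricts, along an injective enumeration `e`, to updating slot `l`. [folklore] -/
theorem subfamily_update {k m : ℕ} (g : Fin k → α → ℝ) (e : Fin m → Fin k) (he : Injective e) (l : Fin m) (v : α → ℝ) :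
    (fun j => update g (e l) v (e j)) = update (fun j => g (e j)) l v := by
  funext j
  by_cases hj : j = l
  · subst hj; simp
  · rw [update_of_ne hj, update_of_ne (fun h' => hj (he h'))]

omit [Fintype α] in
/-- An update outside the index set does not change the sub-family. [folklore] -/
theorem subfamily_update_of_notMem {k m : ℕ} (g : Fin k → α → ℝ) (e : Fin m → Fin k) {i : Fin k} (hi : ∀ j, e j ≠ i) (v : α → ℝ) :
    (fun j => update g i v (e j)) = fun j => g (e j) := by
  funext j
  rw [update_of_ne (hi j)]

omit [Fintype α] in
/-- Summing a function of the enumerated index over `Fin S.card` is summing over `S`. [folklore] -/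
theorem sum_orderEmbOfFin {k : ℕ} (S : Finset (Fin k)) (φ : Fin k → ℝ) :
    ∑ l : Fin S.card, φ (S.orderEmbOfFin rfl l) = ∑ i ∈ S, φ i := by
  rw [← Finset.sum_coe_sort S]
  exact Fintype.sum_equiv (S.orderIsoOfFin rfl).toEquiv _ _ fun l => rfl

omit [Fintype α] in
/-- Splitting the sum over subsets of `Fin (k+1)` by the pivot `0`. [folklore] -/
theorem sum_finset_fin_succ {k : ℕ} (F : Finset (Fin (k + 1)) → ℝ) :
    ∑ S : Finset (Fin (k + 1)), F S =
      ∑ S' : Finset (Fin k), (F (S'.map (Fin.succAboveEmb 0)) + F (insert 0 (S'.map (Fin.succAboveEmb 0)))) := by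
  have hu : (univ : Finset (Finset (Fin (k + 1)))) =
      (insert (0 : Fin (k + 1)) ((univ : Finset (Fin k)).map (Fin.succAboveEmb 0))).powerset := by
    rw [← Finset.powerset_univ, Fin.univ_succAbove k 0, Finset.cons_eq_insert]
  have hm : ∀ G : Finset (Fin (k + 1)) → ℝ,
      ∑ S ∈ ((univ : Finset (Fin k)).map (Fin.succAboveEmb 0)).powerset, G S =
        ∑ S' : Finset (Fin k), G (S'.map (Fin.succAboveEmb 0)) := by
    intro G
    rw [Finset.map_eq_image, Finset.powerset_image, Finset.sum_image, Finset.powerset_univ]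
    · exact Finset.sum_congr rfl fun S' _ => by rw [Finset.map_eq_image]
    · intro x _ y _ hxy
      exact Finset.image_injective (Fin.succAboveEmb 0).injective hxy
  rw [hu, Finset.sum_powerset_insert (not_mem_map_succAboveEmb 0 _), hm, hm, ← Finset.sum_add_distrib]

/-! ### The identity -/

section Identity

variable (μ μ' ν : α → ℝ) (P₁ : α → ℝ) (t : ℝ)

/-- **The cylinder-slot (conditioning) identity, division-free recursive form, every `k`.**  For weights `μ, μ', ν` with `ν = μ − μ'` and a
function `P₁` with `E_μ[P₁ f] = t·E_{μ'}[f]` for all `f` (e.g. `μ' = μ(·|P)`, `P₁ = 1_P`, `t = μ(P)`; for a product weight and a cylinder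
`P`, `μ'` = the weight with the coordinates of `P` frozen to `1`):
`E^μ_{k+1}(P₁·h, g_0,…,g_{k−1}) = t · Σ_{S ⊆ [k]} E^{μ'}_{|S|+1}(h, g_S) · ([Sᶜ = ∅] − E^ν_{|Sᶜ|}(g_{Sᶜ}))`. [this work] -/
theorem sahiE_marked_eq (hν : ∀ x, ν x = μ x - μ' x) (hP : ∀ f : α → ℝ, ex μ (P₁ * f) = t * ex μ' f) :
    ∀ (k : ℕ) (h : α → ℝ) (g : Fin k → α → ℝ),
      sahiE μ (k + 1) (Matrix.vecCons (P₁ * h) g) = t * ∑ S : Finset (Fin k), markedA μ' h g S * polyB ν g Sᶜ := by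
  have hex : ∀ f : α → ℝ, ex μ f = ex μ' f + ex ν f := fun f => by
    simp only [ex_def, ← Finset.sum_add_distrib]
    exact Finset.sum_congr rfl fun x _ => by rw [hν x]; ring
  intro k
  induction k with
  | zero =>
    intro h g
    have hS : (univ : Finset (Finset (Fin 0))) = {∅} := by
      ext S; simp [eq_iff_true_of_subsingleton]
    have hc : (∅ : Finset (Fin 0))ᶜ = ∅ := Subsingleton.elim _ _
    rw [hS, sum_singleton, hc]
    have e1 : sahiE μ (0 + 1) (Matrix.vecCons (P₁ * h) g) = ex μ (P₁ * h) := rfl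
    have e2 : markedA μ' h g ∅ = ex μ' h := rfl
    have e3 : polyB ν g (∅ : Finset (Fin 0)) = 1 := by
      unfold polyB
      rw [if_pos rfl]
      have e4 : sahiE ν (∅ : Finset (Fin 0)).card (fun j => g ((∅ : Finset (Fin 0)).orderEmbOfFin rfl j)) = 0 := rfl
      rw [e4, sub_zero]
    rw [e1, e2, e3, hP h, mul_one]
  | succ k ih =>
    intro h g
    obtain ⟨g0, g', rfl⟩ : ∃ (g0 : α → ℝ) (g' : Fin k → α → ℝ), g = Matrix.vecCons g0 g' :=
      ⟨g 0, Fin.tail g, (Fin.cons_self_tail g).symm⟩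
    have hrm : Fin.removeNth 0 (Matrix.vecCons g0 g') = g' := by funext i; rfl
    have hz : (Matrix.vecCons g0 g' : Fin (k + 1) → α → ℝ) 0 = g0 := rfl
    -- LEFT: peel slot 1 (= `g0`) and apply the induction hypothesis three times
    rw [sahiE_peel_one μ (P₁ * h) g0 g', show P₁ * h * g0 = P₁ * (h * g0) from mul_assoc _ _ _, ih, ih]
    simp only [ih]
    -- RIGHT: split `S ⊆ Fin (k+1)` by the pivot `0`, and push `A`, `B` through the pivot
    rw [sum_finset_fin_succ]
    have hcomplS : ∀ S' : Finset (Fin k), (S'.map (Fin.succAboveEmb 0))ᶜ = insert (0 : Fin (k + 1)) (S'ᶜ.map (Fin.succAboveEmb 0)) :=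
      fun S' => by
        have := compl_insert_map_succAboveEmb 0 S'ᶜ
        rw [compl_compl] at this
        rw [← this, compl_compl]
    have hcomplI : ∀ S' : Finset (Fin k), (insert (0 : Fin (k + 1)) (S'.map (Fin.succAboveEmb 0)))ᶜ = S'ᶜ.map (Fin.succAboveEmb 0) :=
      fun S' => compl_insert_map_succAboveEmb 0 S'
    -- the recursions of `A` (peel `g0` under `μ'`) and `B` (peel `g0` under `ν`)
    have hA : ∀ S' : Finset (Fin k), markedA μ' h (Matrix.vecCons g0 g') (insert 0 (S'.map (Fin.succAboveEmb 0))) =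
        markedA μ' (h * g0) g' S' + (∑ l ∈ S', markedA μ' h (update g' l (g' l * g0)) S')
          - markedA μ' h g' S' * ex μ' g0 := by
      intro S'
      rw [markedA_insert, hrm, hz, sahiE_peel_one]
      have hmid : ∑ l : Fin S'.card, sahiE μ' (S'.card + 1)
            (Matrix.vecCons h (update (fun i => g' (S'.orderEmbOfFin rfl i)) l (g' (S'.orderEmbOfFin rfl l) * g0))) =
          ∑ l ∈ S', markedA μ' h (update g' l (g' l * g0)) S' := by
        rw [← sum_orderEmbOfFin S' (fun i => markedA μ' h (update g' i (g' i * g0)) S')]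
        refine Finset.sum_congr rfl fun l _ => ?_
        unfold markedA
        rw [← subfamily_update g' (fun j => S'.orderEmbOfFin rfl j) (S'.orderEmbOfFin rfl).injective l]
      rw [hmid]
      rfl
    have hB : ∀ T' : Finset (Fin k), polyB ν (Matrix.vecCons g0 g') (insert 0 (T'.map (Fin.succAboveEmb 0))) =
        (∑ l ∈ T', polyB ν (update g' l (g' l * g0)) T') - polyB ν g' T' * ex ν g0 := by
      intro T'
      rw [polyB_insert, hrm, hz]
      by_cases hT : T' = ∅
      · subst hT
        have e1 : sahiE ν ((∅ : Finset (Fin k)).card + 1)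
            (Matrix.vecCons g0 fun i => g' ((∅ : Finset (Fin k)).orderEmbOfFin rfl i)) = ex ν g0 := rfl
        have e2 : polyB ν g' (∅ : Finset (Fin k)) = 1 := by
          unfold polyB
          rw [if_pos rfl]
          have e4 : sahiE ν (∅ : Finset (Fin k)).card (fun j => g' ((∅ : Finset (Fin k)).orderEmbOfFin rfl j)) = 0 := rfl
          rw [e4, sub_zero]
        rw [e1, Finset.sum_empty, e2]
        ring
      · have hpos : 0 < T'.card := Finset.card_pos.2 (Finset.nonempty_iff_ne_empty.2 hT)
        rw [sahiE_cons_of_pos ν hpos]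
        have hmid : ∑ l : Fin T'.card, sahiE ν T'.card
              (update (fun i => g' (T'.orderEmbOfFin rfl i)) l (g' (T'.orderEmbOfFin rfl l) * g0)) =
            - ∑ l ∈ T', polyB ν (update g' l (g' l * g0)) T' := by
          rw [← sum_orderEmbOfFin T' (fun i => polyB ν (update g' i (g' i * g0)) T'), ← Finset.sum_neg_distrib]
          refine Finset.sum_congr rfl fun l _ => ?_
          unfold polyB
          rw [if_neg hT, zero_sub, neg_neg,
            ← subfamily_update g' (fun j => T'.orderEmbOfFin rfl j) (T'.orderEmbOfFin rfl).injective l]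
        rw [hmid]
        unfold polyB
        rw [if_neg hT]
        ring
    -- locality: updates outside the index set are invisible
    have hAout : ∀ (S' : Finset (Fin k)) (l : Fin k), l ∉ S' → markedA μ' h (update g' l (g' l * g0)) S' = markedA μ' h g' S' := by
      intro S' l hl
      unfold markedA
      rw [subfamily_update_of_notMem g' (fun j => S'.orderEmbOfFin rfl j)
        (fun j h' => hl (by rw [← h']; exact orderEmbOfFin_mem _ _ j))]
    have hBout : ∀ (T' : Finset (Fin k)) (l : Fin k), l ∉ T' → polyB ν (update g' l (g' l * g0)) T' = polyB ν g' T' := by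
      intro T' l hl
      unfold polyB
      rw [subfamily_update_of_notMem g' (fun j => T'.orderEmbOfFin rfl j)
        (fun j h' => hl (by rw [← h']; exact orderEmbOfFin_mem _ _ j))]
    have hsplit : ∀ S' : Finset (Fin k),
        ∑ l : Fin k, markedA μ' h (update g' l (g' l * g0)) S' * polyB ν (update g' l (g' l * g0)) S'ᶜ =
          (∑ l ∈ S', markedA μ' h (update g' l (g' l * g0)) S') * polyB ν g' S'ᶜ
            + markedA μ' h g' S' * ∑ l ∈ S'ᶜ, polyB ν (update g' l (g' l * g0)) S'ᶜ := by
      intro S'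
      rw [← Finset.sum_add_sum_compl S', Finset.sum_mul, Finset.mul_sum]
      congr 1
      · exact Finset.sum_congr rfl fun l hl => by rw [hBout S'ᶜ l (fun h' => (mem_compl.1 h') hl)]
      · exact Finset.sum_congr rfl fun l hl => by rw [hAout S' l (mem_compl.1 hl)]
    -- assemble: both sides are `Σ_{S'} (…)`
    simp only [Finset.mul_sum, Finset.sum_mul]
    rw [Finset.sum_comm, ← Finset.sum_add_distrib, ← Finset.sum_sub_distrib]
    refine Finset.sum_congr rfl fun S' _ => ?_
    rw [← Finset.mul_sum, hsplit S', hcomplS, hcomplI, markedA_map, polyB_map, hrm, hA S', hB S'ᶜ, hex g0]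
    ring

end Identity

end SahiCylinderIdentity

end Summit.CriticalPhenomena.PercolationContinuityZ3.Theorems
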